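import Summits.CriticalPhenomena.PercolationContinuityZ3.Theorems.PercNearOneGluingNoHeavyLowerTailSahiGridPatternPairCert

/-!
# `NoHeavyLowerTail` (crux stmt-CriticalPhenomena-4575), Sahi programme P1: **THE DEFICIT BOUND** — for ANY up-set `V ⊆ [3]^d` and up-sets
# `P, Q`, the rectangle value `Θ_V(P×Q)` exceeds the Harris term `2^d·#(P∩Q∩V)` by at most the number of totally distinct pairs of `P×Q`
# whose third point lies OUTSIDE `V`

Support file (Sahi cell, seat `prim-sahi-p1`, generation 23; `--supports stmt-CriticalPhenomena-4575`).  Pure proofs, no definitions,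
no `sorry`, standard axioms.  Vocabulary of `…SahiGridPattern{SliceForm,Harris,Kleitman,DiagCert}` (`ind`, `TotDist`, `thirdPt`, `thetaVal`).

THE MATHEMATICS.  Write `G(V;P,Q) := 2^d·#(P∩Q∩V) − Θ_V(P×Q)` (`Θ_V(P×Q) = Σ_{q∈P, r∈Q} Θ_V(q,r)`), the 'Conj-P form' of the pattern functional:
`G ≥ 0` for every pair of up-sets is condition (N) of `…DiagCert` for the TRIVIAL vector `2^d·1_V` (true for orthants — `sStarD_principal_ge_harris` — and top
cubes, false in general), and for a diagonal certificate `c` of `V` condition (N) reads `Σ_{P∩Q}(c − 2^d 1_V) ≥ −G(V;P,Q)`: `−G` is the DEFICIT of `V` at `(P,Q)`.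
THIS FILE proves the universal bound (every `d`, all up-sets `V, P, Q`)
  `Θ_V(P×Q) ≤ 2^d·Σ_q 1_P 1_Q 1_V(q) + #{(q,r) ∈ P×Q : q δ̸ r, q̄r ∉ V}`,   i.e.   `−G(V;P,Q) ≤ Lat(P,Q;V̄)`
(`thetaVal_pairSum_le_harris_add_lat`; exact form `−G = Lat(P,Q;V̄) − N(P;Q∖V) − H(Q,P∩V)` in the seat memo gen23 §4b).  Proof: `Θ_V(q,r) = [q δ̸ r](1_V(q) +
1_V(r) − 1_V(q̄r))`; the `1_V(q)` part is the totally-distinct pair count `N(P∩V;Q) ≤ 2^d·#(P∩V∩Q)` (coefficientwise Harris, `sum_ind_totDist_le`), and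
`1_V(r) − 1_V(q̄r) ≤ 1 − 1_V(q̄r)` pointwise.  This is the inner-block half of the product case of the orthant-absorption inequality (memo gen23 §4b: the deficit
of the inner set is paid by the Latin family `QE` of the two-orthant identity through the payer identity `Q_E + W_out = Σ_{w∉X} K_w ≥ 0`).  Nothing here asserts
`PatternPos d` for `d ≥ 4` or any conjecture. [this work]
-/

namespace Summit.CriticalPhenomena.PercolationContinuityZ3.Theorems.SahiGridPattern

open Finset SahiGrid3
open scoped BigOperators

variable {d : ℕ}

/-- Pointwise form of the deficit bound: `1_P(q)1_Q(r)Θ_V(q,r) ≤ 1_{P∩V}(q)1_Q(r)[q δ̸ r] + 1_P(q)1_Q(r)[q δ̸ r](1 − 1_V(q̄r))`. [this work] -/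
theorem ind_mul_thetaVal_le (V P Q : Finset (Pd d)) (q r : Pd d) :
    ind P q * ind Q r * thetaVal V q r
      ≤ ind (P ∩ V) q * ind Q r * (if TotDist q r = true then (1:ℤ) else 0)
        + ind P q * ind Q r * ((if TotDist q r = true then (1:ℤ) else 0) * (1 - ind V (thirdPt q r))) := by
  have hP0 := ind_nonneg' P q; have hQ0 := ind_nonneg' Q r
  have hV1 := ind_le_one' V r; have hV0 := ind_nonneg' V (thirdPt q r); have hVq := ind_nonneg' V q
  rw [ind_inter_eq_mul]
  unfold thetaVal
  by_cases h : TotDist q r = true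
  · rw [if_pos h, if_pos h]
    nlinarith [mul_nonneg hP0 hQ0]
  · rw [if_neg h, if_neg h]
    simp

/-- **THE DEFICIT BOUND** (every `d`, all up-sets `V, P, Q ⊆ [3]^d`):
`Σ_q Σ_r 1_P(q)1_Q(r)Θ_V(q,r) ≤ 2^d·Σ_q 1_P1_Q1_V(q) + Σ_q Σ_r 1_P(q)1_Q(r)[q δ̸ r](1 − 1_V(q̄r))`, i.e. `−G(V;P,Q) ≤ Lat(P,Q;V̄)`:
the amount by which the trivial vector `2^d·1_V` fails condition (N) at `(P,Q)` is at most the number of totally distinct pairs of `P×Q` with third point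
outside `V`. [this work] -/
theorem thetaVal_pairSum_le_harris_add_lat (V P Q : Finset (Pd d)) (hV : IsUpperSet (V : Set (Pd d)))
    (hP : IsUpperSet (P : Set (Pd d))) (hQ : IsUpperSet (Q : Set (Pd d))) :
    (∑ q : Pd d, ∑ r : Pd d, ind P q * ind Q r * thetaVal V q r)
      ≤ 2 ^ d * (∑ q : Pd d, ind P q * ind Q q * ind V q)
        + ∑ q : Pd d, ∑ r : Pd d, ind P q * ind Q r * ((if TotDist q r = true then (1:ℤ) else 0) * (1 - ind V (thirdPt q r))) := by
  -- pointwise bound, summed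
  have hpt : (∑ q : Pd d, ∑ r : Pd d, ind P q * ind Q r * thetaVal V q r)
      ≤ ∑ q : Pd d, ∑ r : Pd d, (ind (P ∩ V) q * ind Q r * (if TotDist q r = true then (1:ℤ) else 0)
          + ind P q * ind Q r * ((if TotDist q r = true then (1:ℤ) else 0) * (1 - ind V (thirdPt q r)))) :=
    Finset.sum_le_sum fun q _ => Finset.sum_le_sum fun r _ => ind_mul_thetaVal_le V P Q q r
  -- coefficientwise Harris for the up-sets `P ∩ V` and `Q`
  have hH := sum_ind_totDist_le d (P ∩ V) Q (isUpperSet_inter_coe hP hV) hQ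
  have hsplit : (∑ q : Pd d, ∑ r : Pd d, (ind (P ∩ V) q * ind Q r * (if TotDist q r = true then (1:ℤ) else 0)
          + ind P q * ind Q r * ((if TotDist q r = true then (1:ℤ) else 0) * (1 - ind V (thirdPt q r)))))
      = (∑ q : Pd d, ∑ r : Pd d, ind (P ∩ V) q * ind Q r * (if TotDist q r = true then (1:ℤ) else 0))
        + ∑ q : Pd d, ∑ r : Pd d, ind P q * ind Q r * ((if TotDist q r = true then (1:ℤ) else 0) * (1 - ind V (thirdPt q r))) := by
    rw [← Finset.sum_add_distrib]
    refine Finset.sum_congr rfl fun q _ => ?_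
    rw [← Finset.sum_add_distrib]
  have hdiag : (∑ q : Pd d, ind (P ∩ V) q * ind Q q) = ∑ q : Pd d, ind P q * ind Q q * ind V q := by
    refine Finset.sum_congr rfl fun q _ => ?_
    rw [ind_inter_eq_mul]; ring
  rw [hsplit] at hpt
  rw [hdiag] at hH
  linarith

/-- **Set form**: `Σ_{q∈P} Σ_{r∈Q} Θ_V(q,r) ≤ 2^d·#(P∩Q∩V) + Σ_{q∈P} Σ_{r∈Q} [q δ̸ r](1 − 1_V(q̄r))`. [this work] -/
theorem thetaVal_rect_le_harris_add_lat (V P Q : Finset (Pd d)) (hV : IsUpperSet (V : Set (Pd d)))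
    (hP : IsUpperSet (P : Set (Pd d))) (hQ : IsUpperSet (Q : Set (Pd d))) :
    (∑ q ∈ P, ∑ r ∈ Q, thetaVal V q r)
      ≤ 2 ^ d * (((P ∩ Q) ∩ V).card : ℤ)
        + ∑ q ∈ P, ∑ r ∈ Q, ((if TotDist q r = true then (1:ℤ) else 0) * (1 - ind V (thirdPt q r))) := by
  have h := thetaVal_pairSum_le_harris_add_lat V P Q hV hP hQ
  have e1 : (∑ q ∈ P, ∑ r ∈ Q, thetaVal V q r) = ∑ q : Pd d, ∑ r : Pd d, ind P q * ind Q r * thetaVal V q r := by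
    rw [sum_mem_eq_sum_ind_mul]
    refine Finset.sum_congr rfl fun q _ => ?_
    rw [sum_mem_eq_sum_ind_mul, Finset.mul_sum]
    refine Finset.sum_congr rfl fun r _ => ?_
    ring
  have e2 : (∑ q ∈ P, ∑ r ∈ Q, ((if TotDist q r = true then (1:ℤ) else 0) * (1 - ind V (thirdPt q r))))
      = ∑ q : Pd d, ∑ r : Pd d, ind P q * ind Q r * ((if TotDist q r = true then (1:ℤ) else 0) * (1 - ind V (thirdPt q r))) := by
    rw [sum_mem_eq_sum_ind_mul]
    refine Finset.sum_congr rfl fun q _ => ?_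
    rw [sum_mem_eq_sum_ind_mul, Finset.mul_sum]
    refine Finset.sum_congr rfl fun r _ => ?_
    ring
  have e3 : (∑ q : Pd d, ind P q * ind Q q * ind V q) = (((P ∩ Q) ∩ V).card : ℤ) := by
    have hq : ∀ q : Pd d, ind P q * ind Q q * ind V q = ind ((P ∩ Q) ∩ V) q := fun q => by
      rw [ind_inter_eq_mul, ind_inter_eq_mul]
    simp_rw [hq]
    rw [show (∑ q : Pd d, ind ((P ∩ Q) ∩ V) q) = ∑ q ∈ (univ : Finset (Pd d)), ind ((P ∩ Q) ∩ V) q from rfl,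
      sum_ind_eq_card_inter, Finset.inter_univ]
  rw [e1, e2, ← e3]
  exact h

end Summit.CriticalPhenomena.PercolationContinuityZ3.Theorems.SahiGridPattern
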